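import Mathlib
import HarnessLib

/-!
# `NoHeavyLowerTail` (stmt-CriticalPhenomena-4575) — the algebraic core of the attached-champion inequality for an
# observer whose Steiner region touches two relays

Lead of the crux, 2026-08-18.  In the Steiner-region form of XZ (`stub_attachedChampion`; memo ATTACHED-CHAMPION.md,
Addendum 6) an observer `o` whose region `R` has boundary relays `{b, b'} ∌ q` contributes
`E = p_{b0}·u + p_{b'0}·u' + β·v`, where `u = s_q − s_b`, `u' = s_q − s_{b'}` are the champion's margins in `H₀ = G − R`,
`v` its margin over the glued pair in `H₀ + bb'`, and the region law has atoms `p_{∅0}, p_{∅1}` (observer unattached;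
`b, b'` glued through `R` or not), `p_{b0}, p_{b1}, p_{b'0}, p_{b'1}` (attached to exactly one of them; glued or not), `p₂`
(attached to both), `Γ = p_{∅1} + p_{b1} + p_{b'1} + p₂`, `β = p_{b1} + p_{b'1} + p₂`.  The percolation inputs are:
championship of `q` in `G` (`(1−Γ)u + Γv ≥ 0`, `(1−Γ)u' + Γv ≥ 0`), the two-observer transfer
(`Literature…twoObserver_le_of_lonelier`: `u ≥ 0 ∨ u' ≥ 0 → v ≥ 0`) and Harris' inequality for the increasing events
"attached" and "glued" of the region percolation in odds form (`p_{∅1}(p_{b0} + p_{b'0}) ≤ β·p_{∅0}`).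

* `twoBoundary_core` : from exactly these hypotheses, `0 ≤ E`.  This is the measure-free part of the proof that XZ holds
  for every observer whose Steiner region has at most two boundary relays; the measure-theoretic part (product
  factorisation along `R`) is not yet in the tree.
-/

namespace Summit.CriticalPhenomena.PercolationContinuityZ3.Theorems

namespace AttachedChampionTwoBoundary

/-- **Algebraic core of the two-boundary-relay case of XZ.**  See the module docstring for the meaning of the
variables; the `p`'s are the atoms of a probability vector (nonnegativity of `p_{∅0}` is not needed). -/
theorem twoBoundary_core (u u' v pe0 pe1 pb0 pb1 pc0 pc1 p2 : ℝ)
    (he1 : 0 ≤ pe1) (hb0 : 0 ≤ pb0) (hb1 : 0 ≤ pb1) (hc0 : 0 ≤ pc0) (hc1 : 0 ≤ pc1)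
    (h2 : 0 ≤ p2) (hsum : pe0 + pe1 + pb0 + pb1 + pc0 + pc1 + p2 = 1)
    (champ : 0 ≤ (pe0 + pb0 + pc0) * u + (pe1 + pb1 + pc1 + p2) * v)
    (champ' : 0 ≤ (pe0 + pb0 + pc0) * u' + (pe1 + pb1 + pc1 + p2) * v)
    (hstruct : (0 ≤ u ∨ 0 ≤ u') → 0 ≤ v)
    (harris : pe1 * (pb0 + pc0) ≤ (pb1 + pc1 + p2) * pe0) :
    0 ≤ pb0 * u + pc0 * u' + (pb1 + pc1 + p2) * v := by
  -- abbreviations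
  have hβ : 0 ≤ pb1 + pc1 + p2 := by linarith
  have hΓ : 0 ≤ pe1 + pb1 + pc1 + p2 := by linarith
  -- Harris in the form used: β(1−Γ) ≥ Γ (pb0 + pc0)
  have hkey : (pe1 + pb1 + pc1 + p2) * (pb0 + pc0) ≤ (pb1 + pc1 + p2) * (pe0 + pb0 + pc0) := by nlinarith
  rcases le_or_gt 0 u with hu | hu
  · rcases le_or_gt 0 u' with hu' | hu'
    · -- Case A: both margins nonnegative
      have hv : 0 ≤ v := hstruct (Or.inl hu)
      positivity
    · -- Case B: u ≥ 0 > u'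
      have hv : 0 ≤ v := hstruct (Or.inl hu)
      -- Γ > 0, else champ' forces u' ≥ 0
      have hΓpos : 0 < pe1 + pb1 + pc1 + p2 := by
        rcases lt_or_eq_of_le hΓ with h | h
        · exact h
        · exfalso
          have h1 : pe0 + pb0 + pc0 = 1 := by linarith
          rw [← h, h1] at champ'
          linarith
      -- β Γ v ≥ β (1−Γ)(−u') ≥ Γ pc0 (−u')
      have hc : (pe0 + pb0 + pc0) * (-u') ≤ (pe1 + pb1 + pc1 + p2) * v := by linarith
      have h4 := mul_le_mul_of_nonneg_left hc hβ
      have hkey' := mul_le_mul_of_nonneg_right hkey (le_of_lt (neg_pos.2 hu'))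
      have hnn : 0 ≤ (pe1 + pb1 + pc1 + p2) * pb0 * (-u') :=
        mul_nonneg (mul_nonneg hΓ hb0) (le_of_lt (neg_pos.2 hu'))
      have h3 : (pe1 + pb1 + pc1 + p2) * (pc0 * (-u')) ≤
          (pe1 + pb1 + pc1 + p2) * ((pb1 + pc1 + p2) * v) := by nlinarith [h4, hkey', hnn]
      have h5 : pc0 * (-u') ≤ (pb1 + pc1 + p2) * v := le_of_mul_le_mul_left h3 hΓpos
      nlinarith [h5, mul_nonneg hb0 hu]
  · rcases le_or_gt 0 u' with hu' | hu'
    · -- Case C: u < 0 ≤ u'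
      have hv : 0 ≤ v := hstruct (Or.inr hu')
      have hΓpos : 0 < pe1 + pb1 + pc1 + p2 := by
        rcases lt_or_eq_of_le hΓ with h | h
        · exact h
        · exfalso
          have h1 : pe0 + pb0 + pc0 = 1 := by linarith
          rw [← h, h1] at champ
          linarith
      have hc : (pe0 + pb0 + pc0) * (-u) ≤ (pe1 + pb1 + pc1 + p2) * v := by linarith
      have h4 := mul_le_mul_of_nonneg_left hc hβ
      have hkey' := mul_le_mul_of_nonneg_right hkey (le_of_lt (neg_pos.2 hu))
      have hnn : 0 ≤ (pe1 + pb1 + pc1 + p2) * pc0 * (-u) :=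
        mul_nonneg (mul_nonneg hΓ hc0) (le_of_lt (neg_pos.2 hu))
      have h3 : (pe1 + pb1 + pc1 + p2) * (pb0 * (-u)) ≤
          (pe1 + pb1 + pc1 + p2) * ((pb1 + pc1 + p2) * v) := by nlinarith [h4, hkey', hnn]
      have h5 : pb0 * (-u) ≤ (pb1 + pc1 + p2) * v := le_of_mul_le_mul_left h3 hΓpos
      nlinarith [h5, mul_nonneg hc0 hu']
    · -- Case D: both margins negative
      have hΓpos : 0 < pe1 + pb1 + pc1 + p2 := by
        rcases lt_or_eq_of_le hΓ with h | h
        · exact h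
        · exfalso
          have h1 : pe0 + pb0 + pc0 = 1 := by linarith
          rw [← h, h1] at champ
          linarith
      -- with M = max(−u, −u'): Γ v ≥ (1−Γ) M, and β(1−Γ) ≥ Γ (pb0 + pc0)
      rcases le_or_gt u u' with huu | huu
      · -- −u ≥ −u' : M = −u
        have hc : (pe0 + pb0 + pc0) * (-u) ≤ (pe1 + pb1 + pc1 + p2) * v := by linarith
        have h4 := mul_le_mul_of_nonneg_left hc hβ
        have hkey' := mul_le_mul_of_nonneg_right hkey (le_of_lt (neg_pos.2 hu))
        have h3 : (pe1 + pb1 + pc1 + p2) * ((pb0 + pc0) * (-u)) ≤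
            (pe1 + pb1 + pc1 + p2) * ((pb1 + pc1 + p2) * v) := by nlinarith [h4, hkey']
        have h5 : (pb0 + pc0) * (-u) ≤ (pb1 + pc1 + p2) * v := le_of_mul_le_mul_left h3 hΓpos
        nlinarith [h5, mul_nonneg hc0 (show 0 ≤ u' - u by linarith)]
      · have hc : (pe0 + pb0 + pc0) * (-u') ≤ (pe1 + pb1 + pc1 + p2) * v := by linarith
        have h4 := mul_le_mul_of_nonneg_left hc hβ
        have hkey' := mul_le_mul_of_nonneg_right hkey (le_of_lt (neg_pos.2 hu'))
        have h3 : (pe1 + pb1 + pc1 + p2) * ((pb0 + pc0) * (-u')) ≤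
            (pe1 + pb1 + pc1 + p2) * ((pb1 + pc1 + p2) * v) := by nlinarith [h4, hkey']
        have h5 : (pb0 + pc0) * (-u') ≤ (pb1 + pc1 + p2) * v := le_of_mul_le_mul_left h3 hΓpos
        nlinarith [h5, mul_nonneg hb0 (show 0 ≤ u - u' by linarith)]

end AttachedChampionTwoBoundary

end Summit.CriticalPhenomena.PercolationContinuityZ3.Theorems
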